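import Literature.AnabelianGeometry.EtaleTheta.KummerNaturalityPartialAut
import HarnessLib

/-!
# Kummer classes related by a `Ẑ^×`-twist: evaluation at an "inertia" element fixing the roots of unity
# (the mechanism of [AbsTopIII] Prop. 1.6 (iii) / [IUTchI] Ex. 5.1 (v) law (b′); proof-only)

Sources.  LANA Project interim report [LANA2026Report], §6.1 pp. 31–32 (the Kummer map
`κ : M → lim_{→ H} H¹(H, Λ(M))`); S. Mochizuki, *Topics in Absolute Anabelian Geometry III*, Prop. 1.6 (iii)
p. 36 (the Kummer class of a rational function, restricted to the inertia/decomposition group of a closed point,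
records its ORDER at the point) and *Inter-universal Teichmüller theory I*, Example 5.1 (v) p. 127 l. 76 – p. 128
l. 2 ("by considering divisors of zeroes and poles … associated to Kummer classes of rational functions as in
[AbsTopIII], Proposition 1.6, (iii), from the elementary observation `ℚ_{>0} ∩ Ẑ^× = {1}`")
[MochizukiAbsTopIII2015] [Mochizuki2012]; classical: `Ẑ` is torsion-free and determined by its levels
[RibesZalesskii2010, Thm 2.7.1] (tree: `ZHatLevel.ext_of_level`, abc-iut-w4-d024).

**What this file proves** (PROOF-ONLY: no definition, no `Prop` fact; classical Kummer bookkeeping).  Let `G ↷ A`,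
`S` a directed system of subgroups, `κ = kummerMap`, and `u ∈ Ẑ^× = Aut(Ẑ)` acting on the container by
`H1ColimTwist` (abc-iut-w4-d056, `KummerContainerZHatTwist.lean`).
* `RootSystem.kummerCocycle_eq_zhatTwist_of_kummerClass_eq` — LEVEL FORM: if `κ_H(b) = u · κ_H(a)` in
  `H¹(H, Λ A)` then, at every `τ ∈ H` FIXING `Λ(A)` POINTWISE, the Kummer cocycles satisfy
  `(τ yₙ)/yₙ = ((τ xₙ)/xₙ)^{χₙ(u)}` — the two cocycles differ by a coboundary `(h ζ)/ζ`, which vanishes at `τ`;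
* `exists_level_kummerClass_eq_H1Twist_of_kummerMap_eq` — COLIMIT TO LEVEL: `κ(b) = u · κ(a)` in
  `lim_{→} H¹(S i, Λ A)` gives the level identity at some deeper level `S j` (exactness of the direct limit,
  `AddCommGroup.DirectLimit.of.zero_exact`, + `resH1_kummerClass` / `resH1_H1Twist`);
* `smul_pow_root_div_eq` — if `(τ xₙ)/xₙ = c` with `c` torsion fixed by `τ`, then `(τᵏ xₙ)/xₙ = cᵏ`;
* `ZHatLevel.apply_eta_eq_eta_of_forall_zpow` — ARITHMETIC: if `ξₙ` is a primitive `n`-th root for every `n` and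
  `(ξₙ^{d′})ᵏ = ((ξₙ^{d})ᵏ)^{χₙ(u)}` for all `n` (`k ≥ 1`), then `u(η d) = η d′` in `Ẑ` (levels `n·k`; `Ẑ` has no
  `k`-torsion);
* **`apply_eta_eq_eta_of_kummerMap_eq_twist`** — ASSEMBLY: if `κ(b) = u · κ(a)`, `τ ∈ G` fixes every root of
  unity of `A`, some positive power of `τ` lies in every level `S j`, and `τ` acts on compatible roots of `a`, `b`
  by `(τ xₙ)/xₙ = ξₙ^{d}`, `(τ yₙ)/yₙ = ξₙ^{d′}` ("the orders of `a`, `b` at the point are `d`, `d′`"), then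
  **`u(η d) = η d′`** — exactly the conclusion of hypothesis (b′) `hord` of `CoricPair.kummerRigid_of_divisors`.

Consumer: `Literature/IUT/HodgeTheaters/GlobalFrobenioidsCoricRigidityOfInertia.lean` (law (b′) of [IUTchI]
Ex. 5.1 (v), GAP-LEDGER G-w4d056-2, reduced to the inertia law at the points).  HONEST FRAMING: OUR kernel check
of classical statements; nothing here bears on [IUTchIII] Cor. 3.12; no statement of the disputed series is
asserted.  Groups and modules live in `Type` (Mathlib's `groupCohomology` is single-universe).
-/

namespace Literature.AnabelianGeometry.EtaleTheta

open groupCohomology ProfiniteGrp ProfiniteGrp.ProfiniteCompletion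

/-! ## Iterating an element that fixes the root of unity `(τ x)/x` -/

section Iterate

variable {G : Type*} [Group G] {A : Type*} [CommGroup A] [MulDistribMulAction G A]

/-- If `τ` fixes `c` then so does every power of `τ`. [cite: LANA2026Report, §6.1 p.31] -/
theorem pow_smul_eq_of_smul_eq (τ : G) {c : A} (hc : τ • c = c) (k : ℕ) : τ ^ k • c = c := by
  induction k with
  | zero => rw [pow_zero, one_smul]
  | succ k ih => rw [pow_succ, mul_smul, hc, ih]

/-- **Iteration**: if `τ · x = c · x` with `c` fixed by `τ` [e.g. `c` a root of unity and `τ` an inertia element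
in residue characteristic `0`], then `τᵏ · x = cᵏ · x`, i.e. `(τᵏ x)/x = ((τ x)/x)ᵏ`.
[cite: MochizukiAbsTopIII2015, Proposition 1.6 (iii) p.36] -/
theorem smul_pow_root_div_eq (τ : G) {x c : A} (hx : τ • x / x = c) (hc : τ • c = c) (k : ℕ) :
    τ ^ k • x / x = c ^ k := by
  have hx' : τ • x = c * x := by rw [← hx, div_mul_cancel]
  induction k with
  | zero => rw [pow_zero, one_smul, div_self', pow_zero]
  | succ k ih =>
    have ih' : τ ^ k • x = c ^ k * x := by rw [← ih, div_mul_cancel]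
    rw [pow_succ, mul_smul, hx', smul_mul', pow_smul_eq_of_smul_eq τ hc, ih', pow_succ', ← mul_assoc,
      mul_div_assoc, div_self', mul_one]

end Iterate

/-! ## Level form: twisted equality of Kummer classes, evaluated at an element fixing `Λ(A)` -/

section Level

variable {G : Type} [Group G] {A : Type} [CommGroup A] [MulDistribMulAction G A] (H : Subgroup G)
  [RootableBy A ℕ]

/-- **LEVEL FORM.**  If `κ_H(b) = u · κ_H(a)` in `H¹(H, Λ(A))` (`H1Twist`), then for every `τ ∈ H` that fixes the
cyclotome `Λ(A)` pointwise and all compatible root systems `x` of `a`, `y` of `b`: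
`(τ yₙ)/yₙ = ((τ xₙ)/xₙ)^{χₙ(u)}` for every `n` — the two `1`-cocycles differ by a coboundary `h ↦ (h ζ)/ζ`
(`groupCohomology.H1π_eq_iff`), and the coboundary VANISHES at `τ`.
[cite: MochizukiAbsTopIII2015, Proposition 1.6 (iii) p.36] -/
theorem RootSystem.kummerCocycle_eq_zhatTwist_of_kummerClass_eq {a b : A}
    (ha : a ∈ invariants (A := A) H) (hb : b ∈ invariants (A := A) H)
    (u : MulAut (completion (GrpCat.of (Multiplicative ℤ))))
    (h : kummerClass H ⟨b, hb⟩ = H1Twist (A := A) H u (kummerClass H ⟨a, ha⟩))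
    (τ : H) (hτ : ∀ ζ : cyclotome A, τ • ζ = ζ) (x : RootSystem a) (y : RootSystem b) :
    y.kummerCocycle hb τ = cyclotome.zhatTwist A u (x.kummerCocycle ha τ) := by
  rw [kummerClass_eq_of_rootSystem H ⟨b, hb⟩ y, kummerClass_eq_of_rootSystem H ⟨a, ha⟩ x] at h
  change kummerClassOfRootSystem H y hb = H1Twist (A := A) H u (kummerClassOfRootSystem H x ha) at h
  rw [kummerClassOfRootSystem, kummerClassOfRootSystem, H1Twist, H1π_comp_map_apply, H1π_eq_iff] at h
  obtain ⟨z, hz⟩ := isMulCoboundary₁_of_mem_coboundaries₁ _ h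
  have hzτ := hz τ
  rw [hτ z, div_self'] at hzτ
  -- unfold the difference of the two cocycles at `τ`: the coboundary vanishes there
  have key : (1 : cyclotome A) = y.kummerCocycle hb τ / cyclotome.zhatTwist A u (x.kummerCocycle ha τ) := by
    refine hzτ.trans ?_
    change Additive.toMul ((kummerCocycles₁ H y hb) τ -
      (cyclotomeRepTwist (A := A) H u).hom (kummerCocycles₁ H x ha ((MonoidHom.id H) τ))) = _
    rw [kummerCocycles₁_apply, MonoidHom.id_apply, kummerCocycles₁_apply, cyclotomeRepTwist_hom_apply,
      toMul_ofMul]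
    rfl
  exact div_eq_one.mp key.symm

end Level

/-! ## From the colimit to a level -/

section Colim

variable {G : Type} [Group G] {A : Type} [CommGroup A] [MulDistribMulAction G A]
  {ι : Type} [Preorder ι] [DecidableEq ι] [IsDirectedOrder ι] (S : ι → Subgroup G)
  (hS : ∀ ⦃i j : ι⦄, i ≤ j → S j ≤ S i) [RootableBy A ℕ]

/-- **COLIMIT TO LEVEL.**  If `κ(b) = u · κ(a)` in the container `lim_{→ i} H¹(S i, Λ A)` (`H1ColimTwist`), with
`a`, `b` invariant under `S i`, then at some level `S j ≤ S i` the level-`j` Kummer classes satisfy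
`κ_j(b) = u · κ_j(a)` (exactness of Mathlib's direct limit, `AddCommGroup.DirectLimit.of.zero_exact`, and the
compatibility of Kummer classes and twists with restriction). [cite: LANA2026Report, §6.1 p.31] -/
theorem exists_level_kummerClass_eq_H1Twist_of_kummerMap_eq (hc : IsExhausted A S) {a b : A} {i : ι}
    (ha : a ∈ invariants (A := A) (S i)) (hb : b ∈ invariants (A := A) (S i))
    (u : MulAut (completion (GrpCat.of (Multiplicative ℤ))))
    (h : kummerMap hS hc b = H1ColimTwist S hS u (kummerMap hS hc a)) :
    ∃ (j : ι) (_ : i ≤ j) (ha' : a ∈ invariants (A := A) (S j)) (hb' : b ∈ invariants (A := A) (S j)),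
      kummerClass (S j) ⟨b, hb'⟩ = H1Twist (A := A) (S j) u (kummerClass (S j) ⟨a, ha'⟩) := by
  haveI := directedSystem_H1System (A := A) S hS
  rw [kummerMap_eq_of hS hc b i hb, kummerMap_eq_of hS hc a i ha, H1ColimTwist_toColimit, ← sub_eq_zero,
    ← map_sub] at h
  obtain ⟨j, hij, hj⟩ := AddCommGroup.DirectLimit.of.zero_exact (f := H1System (A := A) S hS) i _ h
  have ha' : a ∈ invariants (A := A) (S j) := fun γ => ha ⟨γ, hS hij γ.2⟩
  have hb' : b ∈ invariants (A := A) (S j) := fun γ => hb ⟨γ, hS hij γ.2⟩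
  refine ⟨j, hij, ha', hb', ?_⟩
  rw [map_sub, sub_eq_zero] at hj
  change resH1 (hS hij) (kummerClass (S i) ⟨b, hb⟩) =
    resH1 (hS hij) (H1Twist (A := A) (S i) u (kummerClass (S i) ⟨a, ha⟩)) at hj
  rwa [resH1_kummerClass (hS hij) b hb hb', resH1_H1Twist, resH1_kummerClass (hS hij) a ha ha'] at hj

end Colim

/-! ## Arithmetic in `Ẑ`: from `ξ^{k d′} = (ξ^{k d})^{χ(u)}` at all levels to `u(η d) = η d′` -/

section Arithmetic

variable {A : Type*} [CommGroup A]

/-- **ARITHMETIC.**  Let `ξₙ ∈ A` be a primitive `n`-th root of unity for every `n ≥ 1`, `u ∈ Aut(Ẑ)`, `k ≥ 1`,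
`d, d′ ∈ ℤ`.  If `(ξₙ^{d′})ᵏ = ((ξₙ^{d})ᵏ)^{χₙ(u)}` for every `n`, then `u(η d) = η d′` in `Ẑ`: at level `n·k` the
relation gives `n·k ∣ k(d′ − d χ_{nk}(u))`, so `n ∣ d′ − d χₙ(u)` (compatibility of the characters), i.e. the
level-`n` components of `u(η d)` and `η d′` agree; `Ẑ` is determined by its levels.
[cite: RibesZalesskii2010, Thm 2.7.1] -/
theorem ZHatLevel.apply_eta_eq_eta_of_forall_zpow (ξ : ℕ+ → A) (hξ : ∀ n : ℕ+, IsPrimitiveRoot (ξ n) n)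
    (u : MulAut (completion (GrpCat.of (Multiplicative ℤ)))) {k : ℕ} (hk : 0 < k) {d d' : ℤ}
    (hrel : ∀ n : ℕ+, ((ξ n) ^ d') ^ k = (((ξ n) ^ d) ^ k) ^ (ZHatLevel.levelChar n u).val) :
    u (ZHatLevel.eta d) = ZHatLevel.eta d' := by
  apply ZHatLevel.ext_of_level
  intro n
  -- the relation at level `N = n k`
  set N : ℕ+ := n * ⟨k, hk⟩ with hN
  have hNk : ((N : ℕ) : ℤ) = (n : ℤ) * k := by simp only [hN, PNat.mul_coe, PNat.mk_coe, Nat.cast_mul]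
  have h1 : (ξ N) ^ ((d' - d * (ZHatLevel.levelChar N u).val) * (k : ℤ)) = 1 := by
    have hr := hrel N
    rw [← zpow_natCast, ← zpow_natCast, ← zpow_natCast, ← zpow_mul, ← zpow_mul, ← zpow_mul] at hr
    have hexp : (d' - d * ((ZHatLevel.levelChar N u).val : ℤ)) * (k : ℤ) =
        d' * k - d * (k * ((ZHatLevel.levelChar N u).val : ℤ)) := by ring
    rw [hexp, zpow_sub, hr, mul_inv_cancel]
  have hdvd : ((N : ℕ) : ℤ) ∣ (d' - d * (ZHatLevel.levelChar N u).val) * (k : ℤ) :=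
    ((hξ N).zpow_eq_one_iff_dvd _).mp h1
  rw [hNk] at hdvd
  have hk0 : (k : ℤ) ≠ 0 := by exact_mod_cast hk.ne'
  have hdvd' : (n : ℤ) ∣ d' - d * (ZHatLevel.levelChar N u).val :=
    Int.dvd_of_mul_dvd_mul_right hk0 hdvd
  -- compatibility of the characters: `χ_N(u) ≡ χ_n(u) (mod n)`
  have hχ : ((ZHatLevel.levelChar N u).val : ZMod n) = ZHatLevel.levelChar n u := by
    have hmod := ZHatLevel.val_levelChar_mul_mod n ⟨k, hk⟩ u
    rw [← hN] at hmod
    rw [← ZMod.natCast_mod, hmod, ZMod.natCast_zmod_val]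
  -- compare the level-`n` components
  apply Multiplicative.toAdd.injective
  rw [ZHatLevel.toAdd_level_aut, ZHatLevel.level_eta, ZHatLevel.level_eta, toAdd_ofAdd, toAdd_ofAdd]
  have hcast : ((d' : ℤ) : ZMod n) = ((d * (ZHatLevel.levelChar N u).val : ℤ) : ZMod n) :=
    ((ZMod.intCast_eq_intCast_iff_dvd_sub _ _ _).mpr (by simpa using hdvd')).symm
  rw [hcast]
  push_cast
  rw [hχ, mul_comm]

end Arithmetic

/-! ## Assembly: the twisting element acts on the orders by multiplication -/

section Assembly

variable {G : Type} [Group G] {A : Type} [CommGroup A] [MulDistribMulAction G A]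
  {ι : Type} [Preorder ι] [DecidableEq ι] [IsDirectedOrder ι] (S : ι → Subgroup G)
  (hS : ∀ ⦃i j : ι⦄, i ≤ j → S j ≤ S i) [RootableBy A ℕ]

/-- **`u(η d) = η d′` from `κ(b) = u · κ(a)` and an inertia element** ([AbsTopIII] Prop. 1.6 (iii) / [IUTchI]
Ex. 5.1 (v) law (b′)).  Let `a`, `b` be invariant under the level `S i` with `κ(b) = u · κ(a)` in
`lim_{→ i} H¹(S i, Λ A)`; let `τ ∈ G` FIX EVERY ROOT OF UNITY of `A`, have a positive power in every level
`S j`, and act on compatible roots of `a`, `b` by `(τ xₙ)/xₙ = ξₙ^{d}`, `(τ yₙ)/yₙ = ξₙ^{d′}`, where `ξₙ` is a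
primitive `n`-th root for every `n` [at a point of a curve: `τ` = a topological generator of inertia, `ξ` its
image in `Ẑ(1)`, `d, d′` = the orders of `a, b` at the point].  THEN `u(η d) = η d′` in `Ẑ` — `Ẑ^×` acts on the
orders by multiplication.  PROVED (level form at a power `τᵏ ∈ S j`, iteration, arithmetic).
[cite: MochizukiAbsTopIII2015, Proposition 1.6 (iii) p.36] -/
theorem apply_eta_eq_eta_of_kummerMap_eq_twist (hc : IsExhausted A S) {a b : A} {i : ι}
    (ha : a ∈ invariants (A := A) (S i)) (hb : b ∈ invariants (A := A) (S i))
    (u : MulAut (completion (GrpCat.of (Multiplicative ℤ))))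
    (h : kummerMap hS hc b = H1ColimTwist S hS u (kummerMap hS hc a))
    (τ : G) (hτ : ∀ (ζ : A) (n : ℕ+), ζ ^ (n : ℕ) = 1 → τ • ζ = ζ) (hτS : ∀ j : ι, ∃ k : ℕ, 0 < k ∧ τ ^ k ∈ S j)
    (ξ : ℕ+ → A) (hξ : ∀ n : ℕ+, IsPrimitiveRoot (ξ n) n) {d d' : ℤ}
    (x : RootSystem a) (hx : ∀ n : ℕ+, τ • x.root n / x.root n = (ξ n) ^ d)
    (y : RootSystem b) (hy : ∀ n : ℕ+, τ • y.root n / y.root n = (ξ n) ^ d') :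
    u (ZHatLevel.eta d) = ZHatLevel.eta d' := by
  obtain ⟨j, -, ha', hb', hj⟩ := exists_level_kummerClass_eq_H1Twist_of_kummerMap_eq S hS hc ha hb u h
  obtain ⟨k, hk, hτk⟩ := hτS j
  -- `τᵏ ∈ S j` fixes the cyclotome pointwise
  have hτk' : ∀ ζ : cyclotome A, (⟨τ ^ k, hτk⟩ : S j) • ζ = ζ := fun ζ =>
    Subtype.ext (funext fun n => by
      change (τ ^ k) • (ζ : ℕ+ → A) n = (ζ : ℕ+ → A) n
      exact pow_smul_eq_of_smul_eq τ (hτ _ n (cyclotome.pow_eq_one ζ n)) k)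
  have hlev := RootSystem.kummerCocycle_eq_zhatTwist_of_kummerClass_eq (S j) ha' hb' u hj ⟨τ ^ k, hτk⟩ hτk' x y
  -- roots of unity `ξₙ^{d}`, `ξₙ^{d′}` are fixed by `τ`
  have hξfix : ∀ (n : ℕ+) (e : ℤ), τ • ((ξ n) ^ e) = (ξ n) ^ e := fun n e =>
    hτ _ n (by rw [← zpow_natCast, ← zpow_mul, mul_comm e, zpow_mul, zpow_natCast, (hξ n).pow_eq_one,
      one_zpow])
  refine ZHatLevel.apply_eta_eq_eta_of_forall_zpow ξ hξ u hk fun n => ?_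
  have hn := congrArg (fun ζ : cyclotome A => (ζ : ℕ+ → A) n) hlev
  simp only [RootSystem.kummerCocycle_apply, cyclotome.zhatTwist_apply_coe] at hn
  change (τ ^ k) • y.root n / y.root n = ((τ ^ k) • x.root n / x.root n) ^ _ at hn
  rwa [smul_pow_root_div_eq τ (hy n) (hξfix n d') k, smul_pow_root_div_eq τ (hx n) (hξfix n d) k] at hn

end Assembly

end Literature.AnabelianGeometry.EtaleTheta
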